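import Literature.NumberTheory.LFunctions.SuzukiCanonicalSystemKernelProofs
import HarnessLib

/-!
# Suzuki's kernel `K_ζ^{ω,ν}`: proof of the series representation (4.8) ([Su21] Prop. 4.1 (3)) and the
# discharge of the named fact `Suzuki2021_prop41`

Companion of `SuzukiCanonicalSystem.lean` / `SuzukiCanonicalSystemKernelProofs.lean`. Source: M. Suzuki,
*Hamiltonians arising from L-functions in the Selberg class*, J. Funct. Anal. **281** (2021) 109116 =
arXiv:1606.05726 [Suzuki2021Hamiltonians], §4.1: the Dirichlet coefficients `q_ζ^{ω,ν}` of
`(ζ(s−ω)/ζ(s+ω))^ν` ((4.7)), the series `K(x) = Σ_{n ≤ eˣ} q(n) n^{−1/2} G(x − log n)` ((4.8)) and its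
identification with the spectral kernel (2.6) (Prop. 4.1 (3), «by taking the Fourier inversion formula of
(4.9)» — equivalently, by expanding `Θ = Θ_∞ · Σ q(n) n^{−s}` under the line integral (2.6) and integrating
termwise, which is what is done here).

PROVED HERE (RH-free), for `ω > 0`, `ν ≥ 1`, `νω > 1`:
* §1 the Dirichlet series identity `Σ q_ζ^{ω,ν}(n) n^{−s} = (ζ(s−ω)/ζ(s+ω))^ν` with absolute convergence on
  `Re s > 1 + ω`, for the tree's `suzukiCoeff` ((4.7));
* §2 the termwise integration of (2.6) on `Im z = 1 + ω` and **Prop. 4.1 (3)** for the spectral kernels: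
  `K_ζ^{ω,ν}(x) = Σ_{1 ≤ n < N, log n ≤ x} q(n) n^{−1/2} G_ζ^{ω,ν}(x − log n)` for `0 < x < log N`;
* §3 **`Suzuki2021_prop41_holds : Suzuki2021_prop41`** (clause (1) from `suzuki2021_prop41_i`).

## References

* [Suzuki2021Hamiltonians] M. Suzuki, JFA 281 (2021) 109116 = arXiv:1606.05726, §2 (2.6)–(2.8), §4.1 (4.7)–(4.9), Prop. 4.1.
* [Titchmarsh1986] E. C. Titchmarsh, *The Theory of the Riemann Zeta-Function*, 2nd ed., §1.1 (Dirichlet series of `ζ`, `1/ζ`).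
-/

noncomputable section

open Complex MeasureTheory Filter Topology Set LSeries
open scoped Real ComplexConjugate LSeries.notation

namespace Literature.NumberTheory.LFunctions

/-! ## §1 The Dirichlet series of `q_ζ^{ω,ν}` ((4.7)) -/

/-- Casting a product of real arithmetic functions to `ℂ` gives the Dirichlet convolution of the casts. [folklore] -/
private theorem cast_mul_eq_convolution (f g : ArithmeticFunction ℝ) :
    (fun n => (((f * g) n : ℝ) : ℂ)) = (fun n => ((f n : ℝ) : ℂ)) ⍟ (fun n => ((g n : ℝ) : ℂ)) := by
  funext n
  rw [LSeries.convolution_def, ArithmeticFunction.mul_apply]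
  push_cast
  rfl

/-- The cast of the Dirichlet unit is `δ`. [folklore] -/
private theorem cast_one_eq_delta :
    (fun n => ((((1 : ArithmeticFunction ℝ)) n : ℝ) : ℂ)) = δ := by
  funext n
  rw [ArithmeticFunction.one_apply]
  by_cases h : n = 1 <;> simp [h, LSeries.delta]

/-- `L`-series of a Dirichlet power: if `Σ f(n) n^{-s}` converges absolutely then so does the series of
`f^{∗k}` and `L(f^{∗k})(s) = L(f)(s)^k`. [cite: Titchmarsh1986, §1.1] -/
private theorem LSeries_cast_pow {f : ArithmeticFunction ℝ} {s : ℂ}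
    (hf : LSeriesSummable (fun n => ((f n : ℝ) : ℂ)) s) (k : ℕ) :
    LSeriesSummable (fun n => (((f ^ k) n : ℝ) : ℂ)) s ∧
      L (fun n => (((f ^ k) n : ℝ) : ℂ)) s = (L (fun n => ((f n : ℝ) : ℂ)) s) ^ k := by
  induction k with
  | zero =>
    rw [pow_zero, cast_one_eq_delta, pow_zero, LSeries_delta]
    exact ⟨by
      refine (summable_of_ne_finset_zero (s := {1}) fun n hn => ?_)
      rw [Finset.mem_singleton] at hn
      rw [term_delta]; simp [hn], rfl⟩
  | succ k ih =>
    rw [pow_succ, cast_mul_eq_convolution, pow_succ]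
    exact ⟨ih.1.convolution hf, by rw [LSeries_convolution' ih.1 hf, ih.2]⟩

/-- Shift of the abscissa by a real power weight: `term (n ↦ n^a f(n)) s n = term f (s − a) n`. [folklore] -/
private theorem term_rpow_mul (a : ℝ) (F : ℕ → ℂ) (s : ℂ) (n : ℕ) :
    term (fun m : ℕ => (((m : ℝ) ^ a : ℝ) : ℂ) * F m) s n = term F (s - a) n := by
  rcases eq_or_ne n 0 with rfl | hn
  · simp
  have hn' : (n : ℂ) ≠ 0 := by exact_mod_cast hn
  rw [term_of_ne_zero hn, term_of_ne_zero hn]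
  rw [Complex.ofReal_cpow (Nat.cast_nonneg n)]
  push_cast
  rw [Complex.cpow_sub _ _ hn']
  field_simp

/-- `L (n ↦ n^a f(n)) (s) = L f (s − a)` and the corresponding summability transfer. [folklore] -/
private theorem LSeries_rpow_mul (a : ℝ) (F : ℕ → ℂ) (s : ℂ) :
    L (fun m : ℕ => (((m : ℝ) ^ a : ℝ) : ℂ) * F m) s = L F (s - a) ∧
      (LSeriesSummable F (s - a) → LSeriesSummable (fun m : ℕ => (((m : ℝ) ^ a : ℝ) : ℂ) * F m) s) := by
  have h : term (fun m : ℕ => (((m : ℝ) ^ a : ℝ) : ℂ) * F m) s = term F (s - a) :=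
    funext (term_rpow_mul a F s)
  refine ⟨?_, fun hs => ?_⟩
  · simp only [LSeries, h]
  · simpa [LSeriesSummable, h] using hs

/-- The `ℝ`-valued arithmetic function `n ↦ n^a` of the tree, cast: `rpowArith a n = n^a` for `n ≠ 0`. [folklore] -/
private theorem rpowArith_apply_of_ne_zero (a : ℝ) {n : ℕ} (hn : n ≠ 0) : rpowArith a n = (n : ℝ) ^ a := by
  simp [rpowArith, hn]

/-- Cast of `N^a ⊙ f`: `n ↦ n^a f(n)`. [folklore] -/
private theorem cast_pmul_rpowArith (a : ℝ) (f : ArithmeticFunction ℝ) :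
    (fun n => ((((rpowArith a).pmul f) n : ℝ) : ℂ)) = fun n : ℕ => (((n : ℝ) ^ a : ℝ) : ℂ) * ((f n : ℝ) : ℂ) := by
  funext n
  rw [ArithmeticFunction.pmul_apply]
  rcases eq_or_ne n 0 with rfl | hn
  · simp
  · rw [rpowArith_apply_of_ne_zero a hn]; push_cast; ring

/-- Cast of `f ⊙ N^a`: `n ↦ n^a f(n)`. [folklore] -/
private theorem cast_pmul_rpowArith' (a : ℝ) (f : ArithmeticFunction ℝ) :
    (fun n => (((f.pmul (rpowArith a)) n : ℝ) : ℂ)) = fun n : ℕ => (((n : ℝ) ^ a : ℝ) : ℂ) * ((f n : ℝ) : ℂ) := by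
  rw [ArithmeticFunction.pmul_comm]; exact cast_pmul_rpowArith a f

/-- `L ζ (s) = ζ(s)` for the cast of the tree's `(ζ : ArithmeticFunction ℝ)`, `Re s > 1`. [cite: Titchmarsh1986, §1.1] -/
private theorem LSeries_cast_zeta {s : ℂ} (hs : 1 < s.re) :
    LSeriesSummable (fun n => ((((ArithmeticFunction.zeta : ArithmeticFunction ℝ)) n : ℝ) : ℂ)) s ∧
      L (fun n => ((((ArithmeticFunction.zeta : ArithmeticFunction ℝ)) n : ℝ) : ℂ)) s = riemannZeta s := by
  have hfun : (fun n => ((((ArithmeticFunction.zeta : ArithmeticFunction ℝ)) n : ℝ) : ℂ)) =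
      fun n => ((ArithmeticFunction.zeta n : ℕ) : ℂ) := by
    funext n; rw [ArithmeticFunction.natCoe_apply]; push_cast; rfl
  rw [hfun]
  exact ⟨ArithmeticFunction.LSeriesSummable_zeta_iff.2 hs, ArithmeticFunction.LSeries_zeta_eq_riemannZeta hs⟩

/-- `L (μ · n^{−2ω}) (s) = 1/ζ(s + 2ω)` for `Re s + 2ω > 1`. [cite: Titchmarsh1986, §1.1] -/
private theorem LSeries_cast_moebius_rpow {ω : ℝ} {s : ℂ} (hs : 1 < s.re + 2 * ω) :
    LSeriesSummable (fun n => (((((ArithmeticFunction.moebius : ArithmeticFunction ℝ)).pmul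
      (rpowArith (-2 * ω))) n : ℝ) : ℂ)) s ∧
      L (fun n => (((((ArithmeticFunction.moebius : ArithmeticFunction ℝ)).pmul
        (rpowArith (-2 * ω))) n : ℝ) : ℂ)) s = (riemannZeta (s + 2 * ω))⁻¹ := by
  rw [cast_pmul_rpowArith']
  have hμ : ∀ n : ℕ, ((((ArithmeticFunction.moebius : ArithmeticFunction ℝ)) n : ℝ) : ℂ) =
      ((ArithmeticFunction.moebius n : ℤ) : ℂ) := fun n => by
    rw [ArithmeticFunction.intCoe_apply]; push_cast; rfl
  simp_rw [hμ]
  have hs' : 1 < (s - (((-2 * ω : ℝ)) : ℂ)).re := by simp; linarith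
  have hsum : LSeriesSummable (fun n => ((ArithmeticFunction.moebius n : ℤ) : ℂ)) (s - (((-2 * ω : ℝ)) : ℂ)) :=
    ArithmeticFunction.LSeriesSummable_moebius_iff.2 hs'
  obtain ⟨hL, hS⟩ := LSeries_rpow_mul (-2 * ω) (fun n => ((ArithmeticFunction.moebius n : ℤ) : ℂ)) s
  refine ⟨hS hsum, ?_⟩
  rw [hL]
  have hmul := LSeries_one_mul_Lseries_moebius hs'
  rw [LSeries_one_eq_riemannZeta hs'] at hmul
  rw [(eq_inv_of_mul_eq_one_right hmul)]
  congr 2; push_cast; ring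

/-- **(4.7): the Dirichlet series of `q_ζ^{ω,ν}`** (RH-free): for `Re s > 1 + ω` (and `ω > 0`),
`Σ q_ζ^{ω,ν}(n) n^{−s}` converges absolutely and equals `(ζ(s−ω)/ζ(s+ω))^ν`, for the tree's
`suzukiCoeff ω ν = N^ω ⊙ (ζ^{∗ν} ∗ (μ ⊙ N^{−2ω})^{∗ν})`. [cite: Suzuki2021Hamiltonians, §4.1 eq. (4.7)] -/
theorem LSeries_suzukiCoeff {ω : ℝ} (hω : 0 < ω) (ν : ℕ) {s : ℂ} (hs : 1 + ω < s.re) :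
    LSeriesSummable (fun n => ((suzukiCoeff ω ν n : ℝ) : ℂ)) s ∧
      L (fun n => ((suzukiCoeff ω ν n : ℝ) : ℂ)) s = (riemannZeta (s - ω) / riemannZeta (s + ω)) ^ ν := by
  unfold suzukiCoeff
  rw [cast_pmul_rpowArith]
  set P : ArithmeticFunction ℝ := (ArithmeticFunction.zeta : ArithmeticFunction ℝ) ^ ν *
    (((ArithmeticFunction.moebius : ArithmeticFunction ℝ)).pmul (rpowArith (-2 * ω))) ^ ν with hP
  have hs1 : 1 < (s - (ω : ℂ)).re := by simp; linarith
  have hs2 : 1 < (s - (ω : ℂ)).re + 2 * ω := by simp; linarith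
  obtain ⟨hζs, hζL⟩ := LSeries_cast_zeta hs1
  obtain ⟨hμs, hμL⟩ := LSeries_cast_moebius_rpow (ω := ω) hs2
  obtain ⟨hζνs, hζνL⟩ := LSeries_cast_pow hζs ν
  obtain ⟨hμνs, hμνL⟩ := LSeries_cast_pow hμs ν
  have hPs : LSeriesSummable (fun n => ((P n : ℝ) : ℂ)) (s - ω) := by
    rw [hP, cast_mul_eq_convolution]; exact hζνs.convolution hμνs
  have hPL : L (fun n => ((P n : ℝ) : ℂ)) (s - ω) = (riemannZeta (s - ω) / riemannZeta (s + ω)) ^ ν := by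
    rw [hP, cast_mul_eq_convolution, LSeries_convolution' hζνs hμνs, hζνL, hμνL, hζL, hμL,
      show s - (ω : ℂ) + 2 * ω = s + ω by ring, div_eq_mul_inv, mul_pow]
  obtain ⟨hL, hS⟩ := LSeries_rpow_mul ω (fun n => ((P n : ℝ) : ℂ)) s
  exact ⟨hS hPs, by rw [hL, hPL]⟩

/-! ## §2 Termwise integration of (2.6) on `Im z = 1 + ω` and Prop. 4.1 (3) -/

/-- `½ ∓ ω − i(u + iv)` in coordinates. [folklore] -/
private theorem half_sub_omega_line' (ω u v : ℝ) :
    (1 : ℂ) / 2 - (ω : ℂ) - I * ((u : ℂ) + (v : ℂ) * I) = (((1 / 2 - ω + v : ℝ)) : ℂ) + ((-u : ℝ) : ℂ) * I := by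
  push_cast
  linear_combination (-(v : ℂ)) * I_mul_I

/-- `ξ = γ·ζ` at the two arguments, hence `Θ = Θ_∞ · (ζ(s−ω)/ζ(s+ω))^ν`, on `Im z > ½ + ω`.
[cite: Suzuki2021Hamiltonians, §2 (2.5) and §4.1 (4.10)] -/
theorem suzukiTheta_eq_arch_mul_zeta {ω : ℝ} (hω : 0 < ω) (ν : ℕ) {z : ℂ} (hz : 1 / 2 + ω < z.im) :
    suzukiTheta ω ν z = suzukiThetaArch ω ν z *
      (riemannZeta (1 / 2 - ω - I * z) / riemannZeta (1 / 2 + ω - I * z)) ^ ν := by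
  have hSre : 1 < ((1 : ℂ) / 2 - (ω : ℂ) - I * z).re := by simp; linarith
  have hTre : 1 < ((1 : ℂ) / 2 + (ω : ℂ) - I * z).re := by simp; linarith
  have hξS : riemannXi (1 / 2 - ω - I * z) = xiGammaFactor (1 / 2 - ω - I * z) * riemannZeta (1 / 2 - ω - I * z) :=
    (xiGammaFactor_mul_riemannZeta (fun h => by rw [h] at hSre; norm_num at hSre)
      (Gammaℝ_ne_zero_of_re_pos (by linarith))).symm
  have hξT : riemannXi (1 / 2 + ω - I * z) = xiGammaFactor (1 / 2 + ω - I * z) * riemannZeta (1 / 2 + ω - I * z) :=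
    (xiGammaFactor_mul_riemannZeta (fun h => by rw [h] at hTre; norm_num at hTre)
      (Gammaℝ_ne_zero_of_re_pos (by linarith))).symm
  unfold suzukiTheta suzukiThetaArch
  rw [hξS, hξT, mul_div_mul_comm, mul_pow]

/-- `n^{−s} = n^{−1/2} e^{iz log n}` for `s = ½ − iz`: `(n : ℂ)^s = √n · e^{−iz log n}` (`n ≥ 1`). [folklore] -/
private theorem natCast_cpow_half_sub (z : ℂ) {n : ℕ} (hn : n ≠ 0) :
    (n : ℂ) ^ ((1 : ℂ) / 2 - I * z) = (Real.sqrt n : ℂ) * Complex.exp (-I * z * Real.log n) := by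
  have hn' : (n : ℂ) ≠ 0 := by exact_mod_cast hn
  have hnpos : 0 < (n : ℝ) := by exact_mod_cast Nat.pos_of_ne_zero hn
  rw [Complex.cpow_def_of_ne_zero hn', ← Complex.natCast_log, Real.sqrt_eq_rpow, Real.rpow_def_of_pos hnpos,
    Complex.ofReal_exp, ← Complex.exp_add]
  congr 1
  push_cast
  ring

/-- Integrability of `u ↦ Θ_∞(u + iv)` on every line `v ≥ ½ + ω` (`ω > 0`, `νω > 1`).
[cite: Suzuki2021Hamiltonians, §4.1 eq. (4.2)] -/
theorem integrable_suzukiThetaArch_line {ω : ℝ} (hω : 0 < ω) (ν : ℕ) (hνω : 1 < (ν : ℝ) * ω) {v : ℝ}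
    (hv : 1 / 2 + ω ≤ v) : Integrable fun u : ℝ => suzukiThetaArch ω ν ((u : ℂ) + (v : ℂ) * I) := by
  obtain ⟨C, _, hC⟩ := norm_suzukiThetaArch_line_le hω ν hv
  have hcont : Continuous fun u : ℝ => suzukiThetaArch ω ν ((u : ℂ) + (v : ℂ) * I) :=
    (differentiableOn_suzukiThetaArch hω ν).continuousOn.comp_continuous
      (by fun_prop : Continuous fun u : ℝ => (u : ℂ) + (v : ℂ) * I) fun u => by simpa using hv
  have hmaj : Integrable fun u : ℝ => C * (1 + |u|) ^ (-((ν : ℝ) * ω)) := by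
    have h := integrable_one_add_norm (E := ℝ) (μ := volume) (r := (ν : ℝ) * ω) (by simpa using hνω)
    simpa [Real.norm_eq_abs] using h.const_mul C
  exact hmaj.mono' hcont.aestronglyMeasurable (Eventually.of_forall (hC v le_rfl))

/-- **[Su21] Prop. 4.1 (3) for the spectral kernels, PROVED** (RH-free): for `ω > 0`, `νω > 1`, the
spectral kernel is the (finite) series (4.8) in the spectral archimedean kernel:
`K_ζ^{ω,ν}(x) = Σ_{1 ≤ n < N, log n ≤ x} q_ζ^{ω,ν}(n) n^{−1/2} G_ζ^{ω,ν}(x − log n)` whenever `x < log N`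
(expand `Θ = Θ_∞ · Σ q(n) n^{−s}` under (2.6) on `Im z = 1 + ω` and integrate termwise; the terms with
`log n > x` vanish by Prop. 4.1 (1) for `G`). [cite: Suzuki2021Hamiltonians, Prop. 4.1 (3), eqs. (4.7)–(4.9)] -/
theorem suzuki2021_prop41_iii {ω : ℝ} (hω : 0 < ω) {ν : ℕ} (hν : 1 ≤ ν) (hνω : 1 < (ν : ℝ) * ω)
    (N : ℕ) {x : ℝ} (hxN : x < Real.log (N : ℝ)) :
    suzukiKernel ω ν x =
      ∑ n ∈ Finset.Icc 1 (N - 1),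
        if Real.log (n : ℝ) ≤ x then
          suzukiCoeff ω ν n / Real.sqrt (n : ℝ) * suzukiArchKernel ω ν (x - Real.log (n : ℝ))
        else 0 := by
  set v : ℝ := 1 + ω with hvdef
  have hv : 1 / 2 + ω < v := by rw [hvdef]; linarith
  set q : ℕ → ℂ := fun n => ((suzukiCoeff ω ν n : ℝ) : ℂ) with hq
  set Θa : ℝ → ℂ := fun u => suzukiThetaArch ω ν ((u : ℂ) + (v : ℂ) * I) with hΘa
  -- decay data for `Θ_∞` on the lines `≥ v`
  obtain ⟨C, _, hC⟩ := norm_suzukiThetaArch_line_le hω ν hv.le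
  have hdA := (differentiableOn_suzukiThetaArch hω ν).mono fun w (hw : v ≤ w.im) => by
    simp only [mem_setOf_eq]; linarith
  have hΘa_int : Integrable Θa := integrable_suzukiThetaArch_line hω ν hνω hv.le
  -- the summands
  set σ₀ : ℝ := 3 / 2 + ω with hσ₀
  set F : ℕ → ℝ → ℂ := fun n u =>
    term q ((1 : ℂ) / 2 - I * ((u : ℂ) + (v : ℂ) * I)) n *
      (Θa u * Complex.exp (-I * ((u : ℂ) + (v : ℂ) * I) * (x : ℂ))) with hF
  have hre_s : ∀ u : ℝ, (((1 : ℂ) / 2 - I * ((u : ℂ) + (v : ℂ) * I))).re = σ₀ := by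
    intro u; simp [hσ₀, hvdef]; ring
  -- (4.7) on the line
  have hLq : ∀ u : ℝ, LSeriesSummable q ((1 : ℂ) / 2 - I * ((u : ℂ) + (v : ℂ) * I)) ∧
      L q ((1 : ℂ) / 2 - I * ((u : ℂ) + (v : ℂ) * I)) =
        (riemannZeta ((1 : ℂ) / 2 - I * ((u : ℂ) + (v : ℂ) * I) - ω) /
          riemannZeta ((1 : ℂ) / 2 - I * ((u : ℂ) + (v : ℂ) * I) + ω)) ^ ν := fun u =>
    LSeries_suzukiCoeff hω ν (by rw [hre_s]; rw [hσ₀]; linarith)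
  -- the integrand of (2.6) as the sum of the `F n`
  have hsum_eq : ∀ u : ℝ, suzukiTheta ω ν ((u : ℂ) + (v : ℂ) * I) *
      Complex.exp (-I * ((u : ℂ) + (v : ℂ) * I) * (x : ℂ)) = ∑' n : ℕ, F n u := by
    intro u
    have hz : 1 / 2 + ω < (((u : ℂ) + (v : ℂ) * I)).im := by simpa using hv
    rw [suzukiTheta_eq_arch_mul_zeta hω ν hz]
    have e1 : (1 : ℂ) / 2 - ω - I * ((u : ℂ) + (v : ℂ) * I) = (1 : ℂ) / 2 - I * ((u : ℂ) + (v : ℂ) * I) - ω := by ring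
    have e2 : (1 : ℂ) / 2 + ω - I * ((u : ℂ) + (v : ℂ) * I) = (1 : ℂ) / 2 - I * ((u : ℂ) + (v : ℂ) * I) + ω := by ring
    rw [e1, e2, ← (hLq u).2, LSeries]
    simp only [hF, hΘa]
    have hre : suzukiThetaArch ω ν ((u : ℂ) + (v : ℂ) * I) *
        (∑' n : ℕ, term q ((1 : ℂ) / 2 - I * ((u : ℂ) + (v : ℂ) * I)) n) *
        Complex.exp (-I * ((u : ℂ) + (v : ℂ) * I) * (x : ℂ)) =
        (∑' n : ℕ, term q ((1 : ℂ) / 2 - I * ((u : ℂ) + (v : ℂ) * I)) n) *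
        (suzukiThetaArch ω ν ((u : ℂ) + (v : ℂ) * I) * Complex.exp (-I * ((u : ℂ) + (v : ℂ) * I) * (x : ℂ))) := by
      ring
    rw [hre, ← tsum_mul_right]
  -- integrability of each summand and the value of `∫ ‖F n‖`
  have hF_cont : ∀ n, Continuous (F n) := by
    intro n
    have hΘc : Continuous Θa := (differentiableOn_suzukiThetaArch hω ν).continuousOn.comp_continuous
      (by fun_prop : Continuous fun u : ℝ => (u : ℂ) + (v : ℂ) * I) fun u => by simpa using hv.le
    have hterm : Continuous fun u : ℝ => term q ((1 : ℂ) / 2 - I * ((u : ℂ) + (v : ℂ) * I)) n := by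
      rcases eq_or_ne n 0 with rfl | hn
      · simp only [term_zero]; exact continuous_const
      · simp only [term_of_ne_zero hn]
        refine continuous_const.div ?_ fun u => ?_
        · have hn' : (n : ℂ) ≠ 0 := by exact_mod_cast hn
          exact Continuous.const_cpow (by fun_prop) (Or.inl hn')
        · exact (cpow_ne_zero_iff_of_exponent_ne_zero (by
            intro h; have := congrArg Complex.re h; rw [hre_s] at this; simp [hσ₀] at this; linarith)).2
            (by exact_mod_cast hn)
    exact hterm.mul (hΘc.mul (by fun_prop))
  have hnormF : ∀ n (u : ℝ), ‖F n u‖ = ‖term q (σ₀ : ℂ) n‖ * (‖Θa u‖ * Real.exp (v * x)) := by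
    intro n u
    rw [hF]; simp only
    rw [norm_mul, norm_mul, norm_term_eq, norm_term_eq, hre_s, Complex.ofReal_re, Complex.norm_exp]
    congr 2
    simp only [Complex.mul_re, Complex.mul_im, Complex.neg_re, Complex.neg_im, Complex.add_re,
      Complex.add_im, Complex.I_re, Complex.I_im, Complex.ofReal_re, Complex.ofReal_im]
    ring
  have hF_int : ∀ n, Integrable (F n) := fun n =>
    ((hΘa_int.norm.mul_const (Real.exp (v * x))).const_mul ‖term q (σ₀ : ℂ) n‖).mono'
      (hF_cont n).aestronglyMeasurable (Eventually.of_forall fun u => (hnormF n u).le)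
  have hF_norm_int : ∀ n, ∫ u : ℝ, ‖F n u‖ = ‖term q (σ₀ : ℂ) n‖ * ((∫ u : ℝ, ‖Θa u‖) * Real.exp (v * x)) := by
    intro n
    simp_rw [hnormF n]
    rw [integral_const_mul, integral_mul_const]
  have hF_sum : Summable fun n => ∫ u : ℝ, ‖F n u‖ := by
    simp_rw [hF_norm_int]
    have hsq : LSeriesSummable q (σ₀ : ℂ) := (LSeries_suzukiCoeff hω ν (s := (σ₀ : ℂ))
      (by simp [hσ₀]; linarith)).1
    exact (summable_norm_iff.mpr hsq).mul_right _
  -- termwise integration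
  have hswap := integral_tsum_of_summable_integral_norm hF_int hF_sum
  -- the value of each `∫ F n`
  have hF_val : ∀ n : ℕ, ∫ u : ℝ, F n u =
      ((suzukiCoeff ω ν n / Real.sqrt (n : ℝ) : ℝ) : ℂ) *
        (2 * (Real.pi : ℂ) * invFourierLine (suzukiThetaArch ω ν) v (x - Real.log (n : ℝ))) := by
    intro n
    rcases eq_or_ne n 0 with rfl | hn
    · simp [hF]
    have hsqrt : (Real.sqrt (n : ℝ) : ℂ) ≠ 0 := by
      exact_mod_cast (Real.sqrt_pos.2 (by exact_mod_cast Nat.pos_of_ne_zero hn)).ne'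
    have hpt : ∀ u : ℝ, F n u = ((suzukiCoeff ω ν n / Real.sqrt (n : ℝ) : ℝ) : ℂ) *
        (Θa u * Complex.exp (-I * ((u : ℂ) + (v : ℂ) * I) * (((x - Real.log (n : ℝ) : ℝ)) : ℂ))) := by
      intro u
      rw [hF]; simp only
      rw [term_of_ne_zero hn, hq]; simp only
      rw [natCast_cpow_half_sub _ hn]
      have hE2 : Complex.exp (-I * ((u : ℂ) + (v : ℂ) * I) * (Real.log n : ℂ)) ≠ 0 := Complex.exp_ne_zero _
      have hE : Complex.exp (-I * ((u : ℂ) + (v : ℂ) * I) * (((x - Real.log (n : ℝ) : ℝ)) : ℂ)) =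
          Complex.exp (-I * ((u : ℂ) + (v : ℂ) * I) * (x : ℂ)) *
            (Complex.exp (-I * ((u : ℂ) + (v : ℂ) * I) * (Real.log n : ℂ)))⁻¹ := by
        rw [← Complex.exp_neg, ← Complex.exp_add]
        congr 1
        push_cast
        ring
      rw [hE]
      push_cast
      field_simp
    simp_rw [hpt]
    rw [integral_const_mul]
    congr 1
    unfold invFourierLine
    have hπ : (2 * (Real.pi : ℂ)) ≠ 0 := by exact_mod_cast (by positivity : (2 * Real.pi : ℝ) ≠ 0)
    rw [← mul_assoc, mul_one_div_cancel hπ, one_mul]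
  -- assemble: the complex line transform as a `tsum`, then as a finite sum
  have hK : invFourierLine (suzukiTheta ω ν) v x =
      ∑' n : ℕ, ((suzukiCoeff ω ν n / Real.sqrt (n : ℝ) : ℝ) : ℂ) *
        invFourierLine (suzukiThetaArch ω ν) v (x - Real.log (n : ℝ)) := by
    rw [invFourierLine]
    simp_rw [hsum_eq]
    rw [← hswap]
    simp_rw [hF_val]
    rw [← tsum_mul_left]
    congr 1; funext n
    have hπ : (2 * (Real.pi : ℂ)) ≠ 0 := by exact_mod_cast (by positivity : (2 * Real.pi : ℝ) ≠ 0)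
    rw [← mul_assoc, ← mul_assoc, mul_comm ((1 : ℂ) / (2 * (Real.pi : ℂ))), mul_assoc _ ((1 : ℂ) / _),
      one_div_mul_cancel hπ, mul_one]
  have hvanish : ∀ n : ℕ, n ∉ Finset.Icc 1 (N - 1) →
      ((suzukiCoeff ω ν n / Real.sqrt (n : ℝ) : ℝ) : ℂ) *
        invFourierLine (suzukiThetaArch ω ν) v (x - Real.log (n : ℝ)) = 0 := by
    intro n hn
    rw [Finset.mem_Icc, not_and_or, not_le, not_le] at hn
    rcases hn with h0 | hN
    · have : n = 0 := by omega
      subst this; simp [suzukiCoeff, ArithmeticFunction.map_zero]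
    · have hn1 : 1 ≤ n := by omega
      have hneg : x - Real.log (n : ℝ) < 0 := by
        rcases Nat.eq_zero_or_pos N with hN0 | hN0
        · subst hN0
          simp at hxN
          linarith [Real.log_nonneg (show (1 : ℝ) ≤ n by exact_mod_cast hn1)]
        · have hlog : Real.log (N : ℝ) ≤ Real.log (n : ℝ) :=
            Real.log_le_log (by exact_mod_cast hN0) (by exact_mod_cast (by omega : N ≤ n))
          linarith
      rw [invFourierLine_eq_zero_of_decay hνω hdA hC le_rfl hneg, mul_zero]
  rw [tsum_eq_sum hvanish] at hK
  -- take real parts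
  have hKre : suzukiKernel ω ν x = (invFourierLine (suzukiTheta ω ν) v x).re := rfl
  rw [hKre, hK, Complex.re_sum]
  refine Finset.sum_congr rfl fun n hn => ?_
  rw [Complex.re_ofReal_mul]
  have hG : suzukiArchKernel ω ν (x - Real.log (n : ℝ)) =
      (invFourierLine (suzukiThetaArch ω ν) v (x - Real.log (n : ℝ))).re := rfl
  rw [← hG]
  split_ifs with hle
  · rfl
  · have hneg : x - Real.log (n : ℝ) < 0 := by linarith [lt_of_not_ge hle]
    rw [(suzuki2021_prop41_i hω hν hνω hneg).2, mul_zero]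

/-! ## §3 The named fact `Suzuki2021_prop41`, discharged -/

/-- **[Su21] Prop. 4.1 (1) and (3) for `L = ζ` — the named fact `Suzuki2021_prop41`, PROVED** (RH-free).
[cite: Suzuki2021Hamiltonians, Prop. 4.1 (1), (3)] -/
theorem Suzuki2021_prop41_holds : Suzuki2021_prop41 := by
  intro ω hω ν hν hνω
  refine ⟨fun x hx => suzuki2021_prop41_i hω hν hνω hx, fun N x _ hxN _ => ?_⟩
  exact suzuki2021_prop41_iii hω hν hνω N hxN

end Literature.NumberTheory.LFunctions

end
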